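import Summits.Ventures.CertifiedManyBodySolver.Observables.LocalPairCeilingTL
import Literature.MathematicalPhysics.QuantumLattice.HubbardNNNHoppingTorusLimitCorrelatorWindow
import HarnessLib

/-!
# Thermodynamic-limit correlator rows of the `t–t'` square lattice that use a certified ENERGY WINDOW
# `lo ≤ e₀ ≤ hi` (both rows), and the `d`-wave pair two-point cells they feed (crew hubbard-obs, D-0042)

HONEST FRAMING: first certified bounds on pairing observables; not a superconductivity verdict; every
number certified (two lineages + referee) or labelled float. NOTHING IS ASSERTED HERE: every
bound-valued statement is a `def … : Prop` or takes row predicates as hypotheses; no `sorry`, no new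
axiom, no named fact; zero compute.

Seat hubbard-obs-p1 (`prover-hubbard-obs-p1-g0-0`), companion of `Rows/DopedTLCorr.lean` (§B: the ONE-row
predicates `SquareTTPrimeCorrLowerRow tp U n u r Λ X` etc., energy hypothesis `energyDensityTT' 1 tp U n ≤ u`
only) and of the tree soundness edge landed for this crew,
`InfVolFermionState.IsTorusLimitOf.re_expect_ge_of_window_certificate_TT'_ineq_of_window`
(`HubbardNNNHoppingTorusLimitCorrelatorWindow`, p401181): a window certificate whose identity carries
BOTH energy half-spaces `κ₊ (hi·1 − Γ E_Φ) + κ₋ (Γ E_Φ − lo·1)`, `κ₊, κ₋ ≥ 0` (Wang et al. 2024 §III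
eq. (obsopt)) bounds the correlator of every torus-limit ground state once `lo ≤ e₀ ≤ hi` is certified.
So far no correlator / pair-correlator certificate of the venture could use the cell's certified LOWER
energy rows (#461/#473 at `(8, 7/8, 0)`); with the rows below it can.

* §A `SquareTTPrimeCorrLowerRowW / UpperRowW / OrbitLowerRowW (tp U n) (lo hi r) Λ X` — the state class
  of §B of `Rows/DopedTLCorr.lean` verbatim (torus limits of unit ground states of the sectors
  `(rectN n L, S^z = 0)` of `hubbardTorusTT' L 1 tp U`), TWO rational energy slots `lo, hi` as
  hypotheses `lo ≤ energyDensityTT' 1 tp U n ≤ hi`, conclusion `r ≤ Re ω(X)` / `Re ω(X) ≤ r` / orbit mean;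
  M3′ cells `M3CorrLowerRowW / UpperRowW / OrbitLowerRowW` at `U = 8`, `n = 7/8`.
* §B solver-free edges (one-row ⇒ two-row, negation, monotonicity, orbit rows at `S = {1}`, `.uncond`
  from the typed two-sided energy row `M3EnergyRow tp lo hi` of `Statement.lean`, NON-VACUITY);
  §C instantiation schemas `….of_window_certificate` (both multipliers, rational slots); §D the `d`-wave
  pair word `dWavePairWord` (`rfl` to `ω.dWavePairCorr`) with its certificate-free cells `[-4, 4]`, diagonal
  `≥ 0` — a certified two-row pair cell is INFORMATIVE iff strictly inside. Spec: HOME/obs-p1/PAIRCORR-SDP.md.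
-/

noncomputable section

namespace Summit.Ventures.CertifiedManyBodySolver

open Literature.MathematicalPhysics.QuantumLattice
open Matrix HubbardWave0 Literature.Probability.LatticeModels ThermodynamicLimit Filter Topology
open Literature.MathematicalPhysics.QuantumManyBody.StateRelaxation
open scoped ComplexOrder BigOperators

/-! ## §A  Two-energy-row correlator predicates (`t = 1`, NNN hopping `tp`, coupling `U`, density `n`) -/

section Defs

/-- §A (LOWER form, energy WINDOW). Square lattice `ℤ²`, `t = 1`, NNN hopping `tp`, coupling `U`, density
`n`: for every torus limit `ω` of unit ground states `ψ` of the sectors `(rectN n L_j, S^z = 0)` of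
`hubbardTorusTT' L_j 1 tp U` along `L_j → ∞`, GIVEN `lo ≤ energyDensityTT' 1 tp U n ≤ hi`, `r ≤ Re ω(X)`.
Verbatim trailing-binder shape of
`InfVolFermionState.IsTorusLimitOf.re_expect_ge_of_window_certificate_TT'_ineq_of_window`
(Wang et al. 2024 §III eq. (obsopt): both energy half-spaces as constraints). -/
def SquareTTPrimeCorrLowerRowW (tp U n : ℝ) (lo hi r : ℚ) (Λ : Finset (Site 2)) (X : FermionOp Λ) : Prop :=
  ∀ (ω : InfVolFermionState 2) (Ls : ℕ → ℕ) (ψ : ∀ L, Fock (Orb (FermionTorus 2 L))),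
    Tendsto Ls atTop atTop →
    (∀ j, IsGroundStateInSector (hubbardTorusTT' (Ls j) 1 tp U) (rectN n (Ls j)) 0 (ψ (Ls j))) →
    (∀ j, star (ψ (Ls j)) ⬝ᵥ ψ (Ls j) = 1) → ω.IsTorusLimitOf ψ Ls →
    ((lo : ℚ) : ℝ) ≤ energyDensityTT' 1 tp U n → energyDensityTT' 1 tp U n ≤ ((hi : ℚ) : ℝ) →
    ((r : ℚ) : ℝ) ≤ (ω.expect Λ X).re

/-- §A (UPPER form, energy WINDOW): same state class and window hypothesis, conclusion `Re ω(X) ≤ r`. -/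
def SquareTTPrimeCorrUpperRowW (tp U n : ℝ) (lo hi r : ℚ) (Λ : Finset (Site 2)) (X : FermionOp Λ) : Prop :=
  ∀ (ω : InfVolFermionState 2) (Ls : ℕ → ℕ) (ψ : ∀ L, Fock (Orb (FermionTorus 2 L))),
    Tendsto Ls atTop atTop →
    (∀ j, IsGroundStateInSector (hubbardTorusTT' (Ls j) 1 tp U) (rectN n (Ls j)) 0 (ψ (Ls j))) →
    (∀ j, star (ψ (Ls j)) ⬝ᵥ ψ (Ls j) = 1) → ω.IsTorusLimitOf ψ Ls →
    ((lo : ℚ) : ℝ) ≤ energyDensityTT' 1 tp U n → energyDensityTT' 1 tp U n ≤ ((hi : ℚ) : ℝ) →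
    (ω.expect Λ X).re ≤ ((r : ℚ) : ℝ)

/-- §A (`D₄`-ORBIT-MEAN form, energy WINDOW; the honest conclusion of a point-group-reduced two-row
certificate): same state class and window hypothesis, conclusion
`r ≤ |S|⁻¹ Σ_{γ ∈ S} Re ω_{γΛ}(Γ(d4Emb γ 0) X)`. Verbatim trailing-binder shape of
`InfVolFermionState.IsTorusLimitOf.re_sum_expect_d4_ge_of_window_certificate_TT'_ineq_of_window`. -/
def SquareTTPrimeCorrOrbitLowerRowW (tp U n : ℝ) (lo hi r : ℚ) (S : Finset (DihedralGroup 4))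
    (Λ : Finset (Site 2)) (X : FermionOp Λ) : Prop :=
  ∀ (ω : InfVolFermionState 2) (Ls : ℕ → ℕ) (ψ : ∀ L, Fock (Orb (FermionTorus 2 L))),
    Tendsto Ls atTop atTop →
    (∀ j, IsGroundStateInSector (hubbardTorusTT' (Ls j) 1 tp U) (rectN n (Ls j)) 0 (ψ (Ls j))) →
    (∀ j, star (ψ (Ls j)) ⬝ᵥ ψ (Ls j) = 1) → ω.IsTorusLimitOf ψ Ls →
    ((lo : ℚ) : ℝ) ≤ energyDensityTT' 1 tp U n → energyDensityTT' 1 tp U n ≤ ((hi : ℚ) : ℝ) →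
    ((r : ℚ) : ℝ) ≤ (S.card : ℝ)⁻¹ *
      ∑ g ∈ S, (ω.expect (d4ShiftSet g 0 Λ) (fermionEmbed (PolySite.d4Emb g 0 Λ) X)).re

/-- M3′ TL correlator LOWER cell with an energy WINDOW at the canonical point `U = 8`, `n = 7/8`
(δ = 1/8), NNN hopping `tp`: `r ≤ Re ω(X)` given `lo ≤ e₀(8, 7/8, tp) ≤ hi`. -/
def M3CorrLowerRowW (tp : ℝ) (lo hi r : ℚ) (Λ : Finset (Site 2)) (X : FermionOp Λ) : Prop :=
  SquareTTPrimeCorrLowerRowW tp 8 (7 / 8) lo hi r Λ X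

/-- M3′ TL correlator UPPER cell with an energy WINDOW at the canonical point. -/
def M3CorrUpperRowW (tp : ℝ) (lo hi r : ℚ) (Λ : Finset (Site 2)) (X : FermionOp Λ) : Prop :=
  SquareTTPrimeCorrUpperRowW tp 8 (7 / 8) lo hi r Λ X

/-- M3′ TL correlator `D₄`-ORBIT-MEAN cell with an energy WINDOW at the canonical point. -/
def M3CorrOrbitLowerRowW (tp : ℝ) (lo hi r : ℚ) (S : Finset (DihedralGroup 4)) (Λ : Finset (Site 2))
    (X : FermionOp Λ) : Prop :=
  SquareTTPrimeCorrOrbitLowerRowW tp 8 (7 / 8) lo hi r S Λ X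

end Defs

/-! ## §B  Solver-free edges -/
section Edges

variable {tp U n : ℝ} {u lo lo' hi hi' r r' : ℚ} {Λ : Finset (Site 2)} {X : FermionOp Λ}

/-- A ONE-row lower row (energy cap `u`) is a two-row lower row on every window with `hi ≤ u`
(the `lo` slot is idle). -/
theorem SquareTTPrimeCorrLowerRowW.of_lowerRow (h : SquareTTPrimeCorrLowerRow tp U n u r Λ X) (hu : hi ≤ u) :
    SquareTTPrimeCorrLowerRowW tp U n lo hi r Λ X :=
  fun ω Ls ψ hLs hψ hψ1 hω _ hhi => h ω Ls ψ hLs hψ hψ1 hω (hhi.trans (by exact_mod_cast hu))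

/-- A ONE-row upper row is a two-row upper row on every window with `hi ≤ u`. -/
theorem SquareTTPrimeCorrUpperRowW.of_upperRow (h : SquareTTPrimeCorrUpperRow tp U n u r Λ X) (hu : hi ≤ u) :
    SquareTTPrimeCorrUpperRowW tp U n lo hi r Λ X :=
  fun ω Ls ψ hLs hψ hψ1 hω _ hhi => h ω Ls ψ hLs hψ hψ1 hω (hhi.trans (by exact_mod_cast hu))

/-- A ONE-row orbit row is a two-row orbit row on every window with `hi ≤ u`. -/
theorem SquareTTPrimeCorrOrbitLowerRowW.of_orbitLowerRow {S : Finset (DihedralGroup 4)}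
    (h : SquareTTPrimeCorrOrbitLowerRow tp U n u r S Λ X) (hu : hi ≤ u) :
    SquareTTPrimeCorrOrbitLowerRowW tp U n lo hi r S Λ X :=
  fun ω Ls ψ hLs hψ hψ1 hω _ hhi => h ω Ls ψ hLs hψ hψ1 hω (hhi.trans (by exact_mod_cast hu))

/-- UPPER two-row rows from LOWER two-row rows on the negated objective. -/
theorem SquareTTPrimeCorrUpperRowW.of_lower_neg (h : SquareTTPrimeCorrLowerRowW tp U n lo hi (-r) Λ (-X)) :
    SquareTTPrimeCorrUpperRowW tp U n lo hi r Λ X := by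
  intro ω Ls ψ hLs hψ hψ1 hω hlo hhi
  have hh := h ω Ls ψ hLs hψ hψ1 hω hlo hhi
  rw [map_neg, Complex.neg_re] at hh
  push_cast at hh
  linarith

/-- LOWER two-row rows from UPPER two-row rows on the negated objective. -/
theorem SquareTTPrimeCorrLowerRowW.of_upper_neg (h : SquareTTPrimeCorrUpperRowW tp U n lo hi (-r) Λ (-X)) :
    SquareTTPrimeCorrLowerRowW tp U n lo hi r Λ X := by
  intro ω Ls ψ hLs hψ hψ1 hω hlo hhi
  have hh := h ω Ls ψ hLs hψ hψ1 hω hlo hhi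
  rw [map_neg, Complex.neg_re] at hh
  push_cast at hh
  linarith

/-- Monotonicity of a two-row lower row: a NARROWER window (`lo ≤ lo'`, `hi' ≤ hi`) and a weaker
constant (`r' ≤ r`). -/
theorem SquareTTPrimeCorrLowerRowW.mono (h : SquareTTPrimeCorrLowerRowW tp U n lo hi r Λ X) (hlo : lo ≤ lo')
    (hhi : hi' ≤ hi) (hr : r' ≤ r) : SquareTTPrimeCorrLowerRowW tp U n lo' hi' r' Λ X := by
  intro ω Ls ψ hLs hψ hψ1 hω hlo' hhi'
  have hh := h ω Ls ψ hLs hψ hψ1 hω (le_trans (by exact_mod_cast hlo) hlo') (hhi'.trans (by exact_mod_cast hhi))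
  exact le_trans (by exact_mod_cast hr) hh

/-- Monotonicity of a two-row upper row: a narrower window and a weaker constant (`r ≤ r'`). -/
theorem SquareTTPrimeCorrUpperRowW.mono (h : SquareTTPrimeCorrUpperRowW tp U n lo hi r Λ X) (hlo : lo ≤ lo')
    (hhi : hi' ≤ hi) (hr : r ≤ r') : SquareTTPrimeCorrUpperRowW tp U n lo' hi' r' Λ X := by
  intro ω Ls ψ hLs hψ hψ1 hω hlo' hhi'
  have hh := h ω Ls ψ hLs hψ hψ1 hω (le_trans (by exact_mod_cast hlo) hlo') (hhi'.trans (by exact_mod_cast hhi))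
  exact hh.trans (by exact_mod_cast hr)

/-- The two-row `D₄`-orbit row at the TRIVIAL label set `S = {1}` IS the plain two-row lower row. -/
theorem squareTTPrimeCorrOrbitLowerRowW_singleton_one_iff :
    SquareTTPrimeCorrOrbitLowerRowW tp U n lo hi r {1} Λ X ↔ SquareTTPrimeCorrLowerRowW tp U n lo hi r Λ X := by
  unfold SquareTTPrimeCorrOrbitLowerRowW SquareTTPrimeCorrLowerRowW
  simp only [Finset.sum_singleton, Finset.card_singleton, Nat.cast_one, inv_one, one_mul,
    InfVolFermionState.expect_fermionEmbed_d4Emb_one_zero]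

/-- UNCONDITIONAL SHAPE at the M3′ point: a two-row lower cell whose window is discharged by the typed
two-sided energy row `M3EnergyRow tp lo' hi'` of `Statement.lean` (any certified window INSIDE the
cell's window: `lo ≤ lo'`, `hi' ≤ hi`) bounds `Re ω(X)` for EVERY state of the class. -/
theorem M3CorrLowerRowW.uncond (h : M3CorrLowerRowW tp lo hi r Λ X) (hE : M3EnergyRow tp lo' hi')
    (hlo : lo ≤ lo') (hhi : hi' ≤ hi) :
    ∀ (ω : InfVolFermionState 2) (Ls : ℕ → ℕ) (ψ : ∀ L, Fock (Orb (FermionTorus 2 L))),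
      Tendsto Ls atTop atTop →
      (∀ j, IsGroundStateInSector (hubbardTorusTT' (Ls j) 1 tp 8) (rectN (7 / 8) (Ls j)) 0 (ψ (Ls j))) →
      (∀ j, star (ψ (Ls j)) ⬝ᵥ ψ (Ls j) = 1) → ω.IsTorusLimitOf ψ Ls →
      ((r : ℚ) : ℝ) ≤ (ω.expect Λ X).re :=
  fun ω Ls ψ hLs hψ hψ1 hω =>
    have hE' : ((lo' : ℚ) : ℝ) ≤ energyDensityTT' 1 tp 8 (7 / 8) ∧ energyDensityTT' 1 tp 8 (7 / 8) ≤ ((hi' : ℚ) : ℝ) := hE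
    h ω Ls ψ hLs hψ hψ1 hω (le_trans (by exact_mod_cast hlo) hE'.1) (hE'.2.trans (by exact_mod_cast hhi))

/-- The same for two-row upper cells. -/
theorem M3CorrUpperRowW.uncond (h : M3CorrUpperRowW tp lo hi r Λ X) (hE : M3EnergyRow tp lo' hi')
    (hlo : lo ≤ lo') (hhi : hi' ≤ hi) :
    ∀ (ω : InfVolFermionState 2) (Ls : ℕ → ℕ) (ψ : ∀ L, Fock (Orb (FermionTorus 2 L))),
      Tendsto Ls atTop atTop →
      (∀ j, IsGroundStateInSector (hubbardTorusTT' (Ls j) 1 tp 8) (rectN (7 / 8) (Ls j)) 0 (ψ (Ls j))) →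
      (∀ j, star (ψ (Ls j)) ⬝ᵥ ψ (Ls j) = 1) → ω.IsTorusLimitOf ψ Ls →
      (ω.expect Λ X).re ≤ ((r : ℚ) : ℝ) :=
  fun ω Ls ψ hLs hψ hψ1 hω =>
    have hE' : ((lo' : ℚ) : ℝ) ≤ energyDensityTT' 1 tp 8 (7 / 8) ∧ energyDensityTT' 1 tp 8 (7 / 8) ≤ ((hi' : ℚ) : ℝ) := hE
    h ω Ls ψ hLs hψ hψ1 hω (le_trans (by exact_mod_cast hlo) hE'.1) (hE'.2.trans (by exact_mod_cast hhi))

/-- The same for two-row orbit cells (conclusion: the `S`-orbit mean). -/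
theorem M3CorrOrbitLowerRowW.uncond {S : Finset (DihedralGroup 4)} (h : M3CorrOrbitLowerRowW tp lo hi r S Λ X)
    (hE : M3EnergyRow tp lo' hi') (hlo : lo ≤ lo') (hhi : hi' ≤ hi) :
    ∀ (ω : InfVolFermionState 2) (Ls : ℕ → ℕ) (ψ : ∀ L, Fock (Orb (FermionTorus 2 L))),
      Tendsto Ls atTop atTop →
      (∀ j, IsGroundStateInSector (hubbardTorusTT' (Ls j) 1 tp 8) (rectN (7 / 8) (Ls j)) 0 (ψ (Ls j))) →
      (∀ j, star (ψ (Ls j)) ⬝ᵥ ψ (Ls j) = 1) → ω.IsTorusLimitOf ψ Ls →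
      ((r : ℚ) : ℝ) ≤ (S.card : ℝ)⁻¹ *
        ∑ g ∈ S, (ω.expect (d4ShiftSet g 0 Λ) (fermionEmbed (PolySite.d4Emb g 0 Λ) X)).re :=
  fun ω Ls ψ hLs hψ hψ1 hω =>
    have hE' : ((lo' : ℚ) : ℝ) ≤ energyDensityTT' 1 tp 8 (7 / 8) ∧ energyDensityTT' 1 tp 8 (7 / 8) ≤ ((hi' : ℚ) : ℝ) := hE
    h ω Ls ψ hLs hψ hψ1 hω (le_trans (by exact_mod_cast hlo) hE'.1) (hE'.2.trans (by exact_mod_cast hhi))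

/-- A one-row M3′ cell is a two-row M3′ cell on every window with `hi ≤ u`. -/
theorem M3CorrLowerRowW.of_lowerRow (h : M3CorrLowerRow tp u r Λ X) (hu : hi ≤ u) :
    M3CorrLowerRowW tp lo hi r Λ X :=
  SquareTTPrimeCorrLowerRowW.of_lowerRow h hu

/-- A one-row M3′ upper cell is a two-row M3′ upper cell on every window with `hi ≤ u`. -/
theorem M3CorrUpperRowW.of_upperRow (h : M3CorrUpperRow tp u r Λ X) (hu : hi ≤ u) :
    M3CorrUpperRowW tp lo hi r Λ X :=
  SquareTTPrimeCorrUpperRowW.of_upperRow h hu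

/-- NON-VACUITY ⇒ CONSISTENCY OF THE SLOTS: for `0 ≤ n ≤ 2` the state class is inhabited along every
`Ls → ∞` (`exists_isTorusLimitOf_sectorGroundState_TT'`), so once the window hypothesis holds a typed
two-row LOWER slot never exceeds a typed two-row UPPER slot on the same objective. -/
theorem SquareTTPrimeCorrLowerRowW.le_of_upperRowW (hl : SquareTTPrimeCorrLowerRowW tp U n lo hi r Λ X)
    (hu' : SquareTTPrimeCorrUpperRowW tp U n lo hi r' Λ X) (hn0 : 0 ≤ n) (hn2 : n ≤ 2)
    (hlo : ((lo : ℚ) : ℝ) ≤ energyDensityTT' 1 tp U n) (hhi : energyDensityTT' 1 tp U n ≤ ((hi : ℚ) : ℝ)) :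
    r ≤ r' := by
  obtain ⟨ψ, φ, ω, hφ, hψ, hψ1, hω, -, -, -⟩ :=
    exists_isTorusLimitOf_sectorGroundState_TT' 1 tp U hn0 hn2 (Ls := id) tendsto_id
  have hLs : Tendsto (id ∘ φ) atTop atTop := hφ.tendsto_atTop
  have h1 := hl ω (id ∘ φ) ψ hLs (fun j => hψ _) (fun j => hψ1 _) hω hlo hhi
  have h2 := hu' ω (id ∘ φ) ψ hLs (fun j => hψ _) (fun j => hψ1 _) hω hlo hhi
  exact_mod_cast h1.trans h2

/-- In particular at the M3′ point, with the window discharged by a typed `M3EnergyRow`. -/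
theorem M3CorrLowerRowW.le_of_upperRowW (hl : M3CorrLowerRowW tp lo hi r Λ X) (hu' : M3CorrUpperRowW tp lo hi r' Λ X)
    (hE : M3EnergyRow tp lo' hi') (hlo : lo ≤ lo') (hhi : hi' ≤ hi) : r ≤ r' := by
  have hE' : ((lo' : ℚ) : ℝ) ≤ energyDensityTT' 1 tp 8 (7 / 8) ∧ energyDensityTT' 1 tp 8 (7 / 8) ≤ ((hi' : ℚ) : ℝ) := hE
  exact SquareTTPrimeCorrLowerRowW.le_of_upperRowW hl hu' (by norm_num) (by norm_num)
    (le_trans (by exact_mod_cast hlo) hE'.1) (hE'.2.trans (by exact_mod_cast hhi))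

end Edges

/-! ## §C  Instantiation schemas: a two-multiplier window certificate PROVES the row -/

section Schemas

/-- **Square lattice, `t–t'`, density `n`, translation-only two-energy-row certificate ⇒
`SquareTTPrimeCorrLowerRowW`.** The data are those of
`InfVolFermionState.IsTorusLimitOf.re_expect_ge_of_window_certificate_TT'_ineq_of_window` at `t = 1`,
`t' = tp`, with the energy edges written at the rational slots `lo, hi` and multipliers `κ₊, κ₋ ≥ 0`;
`hr` places the slot `r` below the certificate value `c − Σ‖aₖ‖ + (Σμ)(n/2 − ν)`. -/
theorem SquareTTPrimeCorrLowerRowW.of_window_certificate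
    (tp : ℝ) {U : ℝ} (hU : 0 ≤ U) {n : ℝ} (hn0 : 0 ≤ n) (hn2 : n < 2) {κp κm : ℝ} (hκp : 0 ≤ κp)
    (hκm : 0 ≤ κm) {lo hi r : ℚ}
    {Λ Λ' : Finset (Site 2)} (hΛ : Λ ⊆ Λ') (h8 : thicken Λ 1 ⊆ Λ')
    (h0 : thicken ({0} : Finset (Site 2)) 1 ⊆ Λ') (hz : (0 : Site 2) ∈ Λ')
    (Xw : FermionOp Λ') (μ : Fin 2 → ℝ) (ν : ℝ)
    {m : Type*} [Fintype m] [DecidableEq m] {Λm : Matrix m m ℂ} (hΛm : Λm.PosSemidef)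
    (O : m → FermionOp Λ')
    {κ' : Type*} (s : Finset κ') (B : κ' → FermionOp Λ)
    {ι : Type*} (tt : Finset ι) (γ : ι → DihedralGroup 4) (hγ1 : ∀ l ∈ tt, γ l = 1) (wv : ι → Site 2)
    (hsh : ∀ l, d4ShiftSet (γ l) (wv l) Λ ⊆ Λ') (Y : ι → FermionOp Λ)
    {ρ : Type*} (uu : Finset ρ) (b : ρ → ℂ) (cw : ρ → List (Orb (PolySite Λ') × Bool))
    (hcw : ∀ j ∈ uu, ladderCharge (cw j) ≠ 0 ∨ ladderSpinCharge (cw j) ≠ 0)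
    {δ : Type*} (ah : Finset δ) (dc : δ → ℝ) (V : δ → FermionOp Λ')
    {κ'' : Type*} (w : Finset κ'') (a : κ'' → ℂ) (word : κ'' → List (Orb (PolySite Λ') × Bool)) {c : ℝ}
    (hcert : Xw - (c : ℂ) • (1 : FermionOp Λ') -
        ∑ σ : Fin 2, ((μ σ : ℝ) : ℂ) • (nAt 0 hz σ - ((ν : ℝ) : ℂ) • (1 : FermionOp Λ')) -
        ((κp : ℝ) : ℂ) • ((((hi : ℚ) : ℝ) : ℂ) • (1 : FermionOp Λ') -
          fermionEmbed (PolySite.incl h0) ((hubbardTTPrimeFermionInteraction 1 tp U).meanEnergyObs 1)) -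
        ((κm : ℝ) : ℂ) • (fermionEmbed (PolySite.incl h0) ((hubbardTTPrimeFermionInteraction 1 tp U).meanEnergyObs 1) -
          (((lo : ℚ) : ℝ) : ℂ) • (1 : FermionOp Λ')) =
      gramForm Λm O +
        (∑ k ∈ s, ((hubbardTTPrimeFermionInteraction 1 tp U).localHamiltonian Λ' *
              fermionEmbed (PolySite.incl hΛ) (B k) -
            fermionEmbed (PolySite.incl hΛ) (B k) * (hubbardTTPrimeFermionInteraction 1 tp U).localHamiltonian Λ') +
          ∑ l ∈ tt, (fermionEmbed (PolySite.incl (hsh l)) (fermionEmbed (PolySite.d4Emb (γ l) (wv l) Λ) (Y l)) -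
            fermionEmbed (PolySite.incl hΛ) (Y l)) +
          ∑ j ∈ uu, b j • ladderWord (cw j)) +
        (∑ m' ∈ ah, ((dc m' : ℝ) : ℂ) • ((V m')ᴴ - V m') + ∑ k ∈ w, a k • ladderWord (word k)))
    (hr : ((r : ℚ) : ℝ) ≤ c - ∑ k ∈ w, ‖a k‖ + (∑ σ : Fin 2, μ σ) * (n / 2 - ν)) :
    SquareTTPrimeCorrLowerRowW tp U n lo hi r Λ' Xw :=
  fun _ω _Ls _ψ hLs hψ hψ1 hω hlo hhi =>
    hr.trans (hω.re_expect_ge_of_window_certificate_TT'_ineq_of_window 1 tp hU hn0 hn2 hκp hκm hlo hhi hΛ h8 h0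
      hz Xw μ ν hΛm O s B tt γ hγ1 wv hsh Y uu b cw hcw ah dc V w a word hcert hLs hψ hψ1)

/-- **Square lattice, `t–t'`, density `n`, `D₄`-reduced two-energy-row certificate (labels `γₗ ∈ S ⊆ D₄`)
⇒ `SquareTTPrimeCorrOrbitLowerRowW … S`.** The data are those of
`InfVolFermionState.IsTorusLimitOf.re_sum_expect_d4_ge_of_window_certificate_TT'_ineq_of_window` at
`t = 1`, `t' = tp`. -/
theorem SquareTTPrimeCorrOrbitLowerRowW.of_window_certificate
    (tp : ℝ) {U : ℝ} (hU : 0 ≤ U) {n : ℝ} (hn0 : 0 ≤ n) (hn2 : n < 2) {κp κm : ℝ} (hκp : 0 ≤ κp)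
    (hκm : 0 ≤ κm) {lo hi r : ℚ}
    {Λ Λ' : Finset (Site 2)} (hΛ : Λ ⊆ Λ') (h8 : thicken Λ 1 ⊆ Λ')
    (h0 : thicken ({0} : Finset (Site 2)) 1 ⊆ Λ') (hz : (0 : Site 2) ∈ Λ')
    {S : Finset (DihedralGroup 4)} (h1 : (1 : DihedralGroup 4) ∈ S) (hmul : ∀ a ∈ S, ∀ b ∈ S, a * b ∈ S)
    (Xw : FermionOp Λ') (μ : Fin 2 → ℝ) (ν : ℝ)
    {m : Type*} [Fintype m] [DecidableEq m] {Λm : Matrix m m ℂ} (hΛm : Λm.PosSemidef)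
    (O : m → FermionOp Λ')
    {κ' : Type*} (s : Finset κ') (B : κ' → FermionOp Λ)
    {ι : Type*} (tt : Finset ι) (γ : ι → DihedralGroup 4) (hγS : ∀ l ∈ tt, γ l ∈ S) (wv : ι → Site 2)
    (hsh : ∀ l, d4ShiftSet (γ l) (wv l) Λ ⊆ Λ') (Y : ι → FermionOp Λ)
    {ρ : Type*} (uu : Finset ρ) (b : ρ → ℂ) (cw : ρ → List (Orb (PolySite Λ') × Bool))
    (hcw : ∀ j ∈ uu, ladderCharge (cw j) ≠ 0 ∨ ladderSpinCharge (cw j) ≠ 0)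
    {δ : Type*} (ah : Finset δ) (dc : δ → ℝ) (V : δ → FermionOp Λ')
    {κ'' : Type*} (w : Finset κ'') (a : κ'' → ℂ) (word : κ'' → List (Orb (PolySite Λ') × Bool)) {c : ℝ}
    (hcert : Xw - (c : ℂ) • (1 : FermionOp Λ') -
        ∑ σ : Fin 2, ((μ σ : ℝ) : ℂ) • (nAt 0 hz σ - ((ν : ℝ) : ℂ) • (1 : FermionOp Λ')) -
        ((κp : ℝ) : ℂ) • ((((hi : ℚ) : ℝ) : ℂ) • (1 : FermionOp Λ') -
          fermionEmbed (PolySite.incl h0) ((hubbardTTPrimeFermionInteraction 1 tp U).meanEnergyObs 1)) -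
        ((κm : ℝ) : ℂ) • (fermionEmbed (PolySite.incl h0) ((hubbardTTPrimeFermionInteraction 1 tp U).meanEnergyObs 1) -
          (((lo : ℚ) : ℝ) : ℂ) • (1 : FermionOp Λ')) =
      gramForm Λm O +
        (∑ k ∈ s, ((hubbardTTPrimeFermionInteraction 1 tp U).localHamiltonian Λ' *
              fermionEmbed (PolySite.incl hΛ) (B k) -
            fermionEmbed (PolySite.incl hΛ) (B k) * (hubbardTTPrimeFermionInteraction 1 tp U).localHamiltonian Λ') +
          ∑ l ∈ tt, (fermionEmbed (PolySite.incl (hsh l)) (fermionEmbed (PolySite.d4Emb (γ l) (wv l) Λ) (Y l)) -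
            fermionEmbed (PolySite.incl hΛ) (Y l)) +
          ∑ j ∈ uu, b j • ladderWord (cw j)) +
        (∑ m' ∈ ah, ((dc m' : ℝ) : ℂ) • ((V m')ᴴ - V m') + ∑ k ∈ w, a k • ladderWord (word k)))
    (hr : ((r : ℚ) : ℝ) ≤ c - ∑ k ∈ w, ‖a k‖ + (∑ σ : Fin 2, μ σ) * (n / 2 - ν)) :
    SquareTTPrimeCorrOrbitLowerRowW tp U n lo hi r S Λ' Xw :=
  fun _ω _Ls _ψ hLs hψ hψ1 hω hlo hhi =>
    hr.trans (hω.re_sum_expect_d4_ge_of_window_certificate_TT'_ineq_of_window 1 tp hU hn0 hn2 hκp hκm hlo hhi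
      hΛ h8 h0 hz h1 hmul Xw μ ν hΛm O s B tt γ hγS wv hsh Y uu b cw hcw ah dc V w a word hcert hLs hψ hψ1)

end Schemas

/-! ## §D  The `d`-wave pair two-point word and its certificate-free two-row cells -/

section Pair

/-- The window `pairRegion S x ∪ pairRegion S y` of the `d`-wave pair two-point word `Φ_x† Φ_y`. -/
abbrev dWavePairRegion (x y : Site 2) : Finset (Site 2) :=
  pairRegion (insert 0 unitSteps) x ∪ pairRegion (insert 0 unitSteps) y

/-- The `d`-wave pair two-point WORD `Γ(Φ_x)† Γ(Φ_y) ∈ 𝔄_{dWavePairRegion x y}`,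
`Φ_x = localPairAt ({0} ∪ unitSteps) dWaveFormFactor x` — literally the word of `InfVolFermionState.corr`,
so that `ω.dWavePairCorr x y = ω.expect (dWavePairRegion x y) (dWavePairWord x y)` by `rfl`
(`dWavePairCorr_eq_expect_word`). The objective `Pd_r` of HOME/obs-p1/PAIRCORR-SDP.md §2 (O1) is the real
part of this word at `(x, y) = (0, r)`. -/
abbrev dWavePairWord (x y : Site 2) : FermionOp (dWavePairRegion x y) :=
  fermionEmbed (PolySite.incl Finset.subset_union_left)
      (localPairAt (insert 0 unitSteps) dWaveFormFactor x)ᴴ *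
    fermionEmbed (PolySite.incl Finset.subset_union_right)
      (localPairAt (insert 0 unitSteps) dWaveFormFactor y)

/-- `ω.dWavePairCorr x y` IS the expectation of `dWavePairWord x y` (definitional). -/
theorem dWavePairCorr_eq_expect_word (ω : InfVolFermionState 2) (x y : Site 2) :
    ω.dWavePairCorr x y = ω.expect (dWavePairRegion x y) (dWavePairWord x y) := rfl

variable {tp U n : ℝ}

/-- Certificate-free two-row LOWER cell `-4` of the `d`-wave pair word at every `(t′, U, n)` and every
window: the a-priori lower EDGE (`Observables/LocalPairCeilingTL.lean`). A certified two-row pair LOWER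
cell is informative iff its constant is `> -4`. -/
theorem squareTTPrime_dWavePair_lowerRowW (tp U n : ℝ) (lo hi : ℚ) (x y : Site 2) :
    SquareTTPrimeCorrLowerRowW tp U n lo hi (-4) (dWavePairRegion x y) (dWavePairWord x y) :=
  SquareTTPrimeCorrLowerRowW.of_lowerRow (squareTTPrime_dWavePair_lowerRow tp U n hi x y) le_rfl

/-- Certificate-free two-row UPPER cell `4` of the `d`-wave pair word at every `(t′, U, n)` and every
window: the a-priori upper EDGE. A certified two-row pair UPPER cell is informative iff `< 4`. -/
theorem squareTTPrime_dWavePair_upperRowW (tp U n : ℝ) (lo hi : ℚ) (x y : Site 2) :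
    SquareTTPrimeCorrUpperRowW tp U n lo hi 4 (dWavePairRegion x y) (dWavePairWord x y) :=
  SquareTTPrimeCorrUpperRowW.of_upperRow (squareTTPrime_dWavePair_upperRow tp U n hi x y) le_rfl

/-- Certificate-free two-row diagonal LOWER cell `0` (`Re ω(Φ_x† Φ_x) ≥ 0`). -/
theorem squareTTPrime_dWavePair_self_lowerRowW (tp U n : ℝ) (lo hi : ℚ) (x : Site 2) :
    SquareTTPrimeCorrLowerRowW tp U n lo hi 0 (dWavePairRegion x x) (dWavePairWord x x) :=
  SquareTTPrimeCorrLowerRowW.of_lowerRow (squareTTPrime_dWavePair_self_lowerRow tp U n hi x) le_rfl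

/-- M3′ point: the a-priori two-row pair box, lower edge `-4`. -/
theorem m3_dWavePair_lowerRowW (tp : ℝ) (lo hi : ℚ) (x y : Site 2) :
    M3CorrLowerRowW tp lo hi (-4) (dWavePairRegion x y) (dWavePairWord x y) :=
  squareTTPrime_dWavePair_lowerRowW tp 8 (7 / 8) lo hi x y

/-- M3′ point: the a-priori two-row pair box, upper edge `4`. -/
theorem m3_dWavePair_upperRowW (tp : ℝ) (lo hi : ℚ) (x y : Site 2) :
    M3CorrUpperRowW tp lo hi 4 (dWavePairRegion x y) (dWavePairWord x y) :=
  squareTTPrime_dWavePair_upperRowW tp 8 (7 / 8) lo hi x y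

/-- M3′ point: the diagonal two-row lower edge `0`. -/
theorem m3_dWavePair_self_lowerRowW (tp : ℝ) (lo hi : ℚ) (x : Site 2) :
    M3CorrLowerRowW tp lo hi 0 (dWavePairRegion x x) (dWavePairWord x x) :=
  squareTTPrime_dWavePair_self_lowerRowW tp 8 (7 / 8) lo hi x

/-- **Reading a two-row pair cell as a bound on `ω.dWavePairCorr`** (the venture's named correlator):
an `M3CorrLowerRowW`/`UpperRowW` pair on the word at `(x, y)`, with the window discharged by a typed
`M3EnergyRow`, boxes `Re ω.dWavePairCorr x y` for every state of the M3′ class. -/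
theorem m3_re_dWavePairCorr_mem_Icc_of_rowsW {tp : ℝ} {lo hi lo' hi' pl pu : ℚ} {x y : Site 2}
    (hl : M3CorrLowerRowW tp lo hi pl (dWavePairRegion x y) (dWavePairWord x y))
    (hu : M3CorrUpperRowW tp lo hi pu (dWavePairRegion x y) (dWavePairWord x y))
    (hE : M3EnergyRow tp lo' hi') (hlo : lo ≤ lo') (hhi : hi' ≤ hi)
    (ω : InfVolFermionState 2) (Ls : ℕ → ℕ) (ψ : ∀ L, Fock (Orb (FermionTorus 2 L)))
    (hLs : Tendsto Ls atTop atTop)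
    (hψ : ∀ j, IsGroundStateInSector (hubbardTorusTT' (Ls j) 1 tp 8) (rectN (7 / 8) (Ls j)) 0 (ψ (Ls j)))
    (hψ1 : ∀ j, star (ψ (Ls j)) ⬝ᵥ ψ (Ls j) = 1) (hω : ω.IsTorusLimitOf ψ Ls) :
    (ω.dWavePairCorr x y).re ∈ Set.Icc ((pl : ℚ) : ℝ) ((pu : ℚ) : ℝ) := by
  rw [Set.mem_Icc, dWavePairCorr_eq_expect_word]
  exact ⟨hl.uncond hE hlo hhi ω Ls ψ hLs hψ hψ1 hω, hu.uncond hE hlo hhi ω Ls ψ hLs hψ hψ1 hω⟩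

end Pair

end Summit.Ventures.CertifiedManyBodySolver

end
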